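import Summits.FinalStateConjecture.FinalStateConjecture.Theorems.ZeroEnergyKerrOrBombStationaryLimitReductionKerrIsometryRigidityWave3Facts
import Summits.FinalStateConjecture.FinalStateConjecture.Theorems.ZeroEnergyKerrOrBombStationaryLimitReductionTimeEquivariantMaps
import Literature.Geometry.Lorentzian.ADMTransitionRigidity
import Literature.Geometry.Lorentzian.CoordSlice
import Literature.Geometry.Lorentzian.KerrStarCoord
import Literature.Geometry.Lorentzian.KerrWaveEnergy
import HarnessLib

/-!
# Route ZeroEnergyKerrOrBomb · crux `FinalStateFromKerrOrBomb` (stmt-FinalStateConjecture-17839), line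
# `SketchIdeator1` — stub `stub_kerrAsymptoticRigidity` (F4 of stub 1R), layer 7: the chart identification drifts
# from its asymptotic Lorentz transformation by at most `O(√r)`

Helper file (`--supports stmt-FinalStateConjecture-17839`; registered helper `kerrAsymptoticRigidity_drift`) of the
lead's wave-2 stub-worker for `stub_kerrAsymptoticRigidity : SigM.stub_kerrAsymptoticRigidity`
(`:= KerrAsymptoticRigidity`, obligation F4 of stub 1R, `…KerrIsometryRigidityWave3Facts`). Hypotheses: the binder
list of `KerrAsymptoticRigidity` VERBATIM, then a linear map `Λ` with `Λ e₀ = c e₀` and the rate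
`‖dΘ_x − Λ‖ ≤ C₆ / r(x)` on `{r ≥ R₆}` (the conclusion of layer 6, `kerrAsymptoticRigidity_fderiv_limit`, p139460).
Conclusion: `‖Θ x − Λ x‖ ≤ C₇ √(r(x))` far out (any exponent `> 0` would do; `1/2` is what the later layers use).

Proof: on the slice, `g(y) = Θ(0, y) − Λ(0, y)` has `‖Dg(y)‖ ≤ ‖dΘ_{(0,y)} − Λ‖ ≤ 2C₆/‖y‖ ≤ 2C₆ ‖y‖^{−1/2}`
far out, so the tree's radial growth lemma (`TransitionRigidity.norm_le_of_norm_fderiv_le_rpow`, `α = 1/2`) gives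
`‖g(y)‖ ≤ M₀ + 4C₆ ‖y‖^{1/2}`; and `Θ x − Λ x = g(x_{space})` by `T`-equivariance (`Θ x = Θ(0, x_{space}) + c x⁰ e₀`,
`apply_eq_apply_foot_add`) and `Λ e₀ = c e₀`.

Elementary; no named fact, nothing restated. References: R. Bartnik, CPAM 39 (1986), §3, Cor. 3.2
(`x − y ∈ W^{2,q}_{1−τ}`: sublinear drift of transition maps); P. T. Chruściel, J. L. Costa, arXiv:0806.0016, §2.1.
-/

set_option linter.dupNamespace false

noncomputable section

open scoped Manifold ContDiff Topology
open Set Filter Function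

namespace Summit.FinalStateConjecture.FinalStateConjecture.Theorems.SymplecticDualOfTheBomb

open Literature.Geometry.Lorentzian
open Summit.FinalStateConjecture.FinalStateConjecture.Theorems.OneLockedExplosion

/-! ## §1 Preliminaries -/

/-- `‖(0, y)‖ = ‖y‖`. [folklore] -/
private theorem norm_ofTimeSpace_zero (y : E3) : ‖E4.ofTimeSpace 0 y‖ = ‖y‖ := by
  have h : ‖E4.ofTimeSpace 0 y‖ ^ 2 = ‖y‖ ^ 2 := by
    rw [EuclideanSpace.real_norm_sq_eq, Fin.sum_univ_four, ← E4.spatialNorm_ofTimeSpace 0 y, E4.spatialNorm_sq]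
    simp
  nlinarith [norm_nonneg (E4.ofTimeSpace 0 y), norm_nonneg y, sq_nonneg (‖E4.ofTimeSpace 0 y‖ - ‖y‖),
    sq_nonneg (‖E4.ofTimeSpace 0 y‖ + ‖y‖)]

/-- The slice inclusion `incl : E3 →L E4` has operator norm `≤ 1`. [folklore] -/
private theorem norm_incl_le_one : ‖(CoordSlice.incl : E3 →L[ℝ] E4)‖ ≤ 1 :=
  ContinuousLinearMap.opNorm_le_bound _ zero_le_one fun y ↦ by
    rw [one_mul, CoordSlice.incl_apply, norm_ofTimeSpace_zero]

/-- `r(0, y) ≥ ‖y‖/2` for `‖y‖ ≥ 2|a|` (`r² ≥ ‖y‖² − a²`). [folklore] -/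
private theorem half_norm_le_radius (a : ℝ) {y : E3} (hy : 2 * |a| ≤ ‖y‖) :
    ‖y‖ / 2 ≤ Kerr.radius a (E4.ofTimeSpace 0 y) := by
  have h1 := Kerr.spatialNorm_sq_sub_sq_le_radius_sq a (E4.ofTimeSpace 0 y)
  rw [E4.spatialNorm_ofTimeSpace] at h1
  have ha : a ^ 2 ≤ (‖y‖ / 2) ^ 2 := by
    rw [← sq_abs a]; exact pow_le_pow_left₀ (abs_nonneg a) (by linarith) 2
  have h2 : (‖y‖ / 2) ^ 2 ≤ Kerr.radius a (E4.ofTimeSpace 0 y) ^ 2 := by nlinarith [norm_nonneg y]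
  exact (pow_le_pow_iff_left₀ (by positivity) (Kerr.radius_nonneg _ _) two_ne_zero).1 h2

/-- `‖x_{space}‖ ≤ r(x) + |a|` on `{r > 0}` (the tree's leaf form `Kerr.norm_le_radius_add_abs`). [folklore] -/
private theorem spatialNorm_le_radius_add {a : ℝ} {x : E4} (hx : 0 < Kerr.radius a x) :
    E4.spatialNorm x ≤ Kerr.radius a x + |a| := by
  have h := Kerr.norm_le_radius_add_abs (a := a) (y := E4.spatial x) (by rwa [Kerr.radius_ofTimeSpace_spatial])
  rwa [Kerr.radius_ofTimeSpace_spatial] at h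

/-! ## §2 The drift bound -/

/-- **Registered helper `kerrAsymptoticRigidity_drift`** (layer 7 of F4 = `KerrAsymptoticRigidity`; its binder list verbatim,
followed by a linear map `Λ` with `Λ e₀ = c e₀` and the rate `‖dΘ_x − Λ‖ ≤ C₆/r(x)` on `{r ≥ R₆}` of layer 6): the chart
identification drifts from `Λ` sublinearly, `‖Θ x − Λ x‖ ≤ C₇ √(r(x))` far out. On the slice, `g(y) = Θ(0, y) − Λ(0, y)`
has `‖Dg(y)‖ ≤ 2C₆ ‖y‖^{−1/2}` far out (`r(0, y) ≥ ‖y‖/2 ≥ 1`), whence `‖g(y)‖ ≤ M₀ + 4C₆ ‖y‖^{1/2}`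
(`TransitionRigidity.norm_le_of_norm_fderiv_le_rpow`, `α = 1/2`); and `Θ x − Λ x = g(x_{space})` by `T`-equivariance
(`apply_eq_apply_foot_add`) and `Λ e₀ = c e₀`; finally `‖x_{space}‖ ≤ r + |a| ≤ 2r`. Bartnik 1986, §3, Cor. 3.2;
Chruściel–Costa arXiv:0806.0016, §2.1. [folklore] -/
theorem kerrAsymptoticRigidity_drift : ∀ (𝓑 : StationaryAFBlackHole.{0}) (A : 𝓑.AdaptedChart) (M a c : ℝ) (Θ : E4 → E4), ChartIsAsymptoticallyCartesian A → ChartIsAsymptoticallySchwarzschildean' A → Kerr.IsSubextremal M a → 0 < c → ContDiffOn ℝ ∞ Θ (Kerr.exterior M a : Set E4) → Set.InjOn Θ (Kerr.exterior M a : Set E4) → Set.MapsTo Θ (Kerr.exterior M a : Set E4) (A.domain : Set E4) → (∀ x ∈ (Kerr.exterior M a : Set E4), ∀ s : ℝ, Θ (x + s • E4.basisVector 0) = Θ x + (c * s) • E4.basisVector 0) → (∀ x ∈ (Kerr.exterior M a : Set E4), ∀ v w : E4, A.bilin (Θ x) (fderiv ℝ Θ x v) (fderiv ℝ Θ x w)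 = Kerr.bilin M a x v w) → Θ '' (Kerr.exterior M a : Set E4) = {u : E4 | ∃ h : u ∈ A.domain, A.toFun ⟨u, h⟩ ∈ 𝓑.doc} → (∀ R₁ : ℝ, ∃ R : ℝ, ∀ x ∈ (Kerr.exterior M a : Set E4), R ≤ Kerr.radius a x → R₁ ≤ A.radius (Θ x)) → ∀ (Λ : E4 →L[ℝ] E4) (R₆ C₆ : ℝ), Λ (E4.basisVector 0) = c • E4.basisVector 0 → (∀ x ∈ (Kerr.exterior M a : Set E4), R₆ ≤ Kerr.radius a x → ‖fderiv ℝ Θ x - Λ‖ ≤ C₆ / Kerr.radius a x) → ∃ R₇ C₇ : ℝ, ∀ x ∈ (Kerr.exterior M a : Set E4), R₇ ≤ Kerr.radius a x → ‖Θ x - Λ x‖ ≤ C₇ * Real.sqrt (Kerr.radius a x) := by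
  intro 𝓑 A M a c Θ _ _ _ _ hΘs _ _ hΘT _ _ _ Λ R₆ C₆ hΛ0 hrate
  set S : Set E4 := (Kerr.exterior M a : Set E4) with hS_def
  have hSo : IsOpen S := (Kerr.exterior M a).isOpen
  have hSinv : ∀ x ∈ S, ∀ s : ℝ, x + s • E4.basisVector 0 ∈ S := kerrRegion_add_smul_mem a _
  -- the far slice region
  set Q : ℝ := max (max R₆ (max (Kerr.rPlus M a) 0 + 1)) (max |a| 1) with hQ_def
  have hQ1 : 1 ≤ Q := (le_max_right _ _).trans (le_max_right _ _)
  set R' : ℝ := 2 * Q with hR'_def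
  have hR'0 : 0 < R' := by positivity
  have hfar' : ∀ y : E3, R' ≤ ‖y‖ → E4.ofTimeSpace 0 y ∈ S ∧ R₆ ≤ Kerr.radius a (E4.ofTimeSpace 0 y) ∧
      ‖y‖ / 2 ≤ Kerr.radius a (E4.ofTimeSpace 0 y) := by
    intro y hy
    have ha : 2 * |a| ≤ ‖y‖ :=
      le_trans (by linarith [le_max_left |a| 1, le_max_right (max R₆ (max (Kerr.rPlus M a) 0 + 1)) (max |a| 1)]) hy
    have hhalf := half_norm_le_radius a ha
    have hQr : Q ≤ Kerr.radius a (E4.ofTimeSpace 0 y) := le_trans (by linarith) hhalf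
    refine ⟨?_, ((le_max_left _ _).trans (le_max_left _ _)).trans hQr, hhalf⟩
    rw [hS_def, SetLike.mem_coe, Kerr.mem_exterior]
    have : max (Kerr.rPlus M a) 0 + 1 ≤ Q := (le_max_right _ _).trans (le_max_left _ _)
    linarith
  -- the slice drift `g(y) = Θ(0, y) − Λ(0, y)` and its derivative
  set g : E3 → E4 := fun y ↦ Θ (E4.ofTimeSpace 0 y) - Λ (E4.ofTimeSpace 0 y) with hg_def
  have hgd : ∀ y : E3, R' ≤ ‖y‖ →
      HasFDerivAt g ((fderiv ℝ Θ (E4.ofTimeSpace 0 y) - Λ).comp CoordSlice.incl) y := by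
    intro y hy
    obtain ⟨hyS, -, -⟩ := hfar' y hy
    have hΘd : DifferentiableAt ℝ Θ (E4.ofTimeSpace 0 y) :=
      (hΘs.contDiffAt (hSo.mem_nhds hyS)).differentiableAt (by simp)
    have h1 : HasFDerivAt (fun y ↦ Θ (E4.ofTimeSpace 0 y)) ((fderiv ℝ Θ (E4.ofTimeSpace 0 y)).comp CoordSlice.incl) y :=
      hΘd.hasFDerivAt.comp y (CoordSlice.hasFDerivAt_ofTimeSpace_zero y)
    have h2 : HasFDerivAt (fun y ↦ Λ (E4.ofTimeSpace 0 y)) ((Λ : E4 →L[ℝ] E4).comp CoordSlice.incl) y :=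
      Λ.hasFDerivAt.comp y (CoordSlice.hasFDerivAt_ofTimeSpace_zero y)
    have h := h1.sub h2
    rwa [← ContinuousLinearMap.sub_comp] at h
  have hbound : ∀ y : E3, R' ≤ ‖y‖ → ‖fderiv ℝ g y‖ ≤ (2 * |C₆|) * ‖y‖ ^ (-(1 / 2 : ℝ)) := by
    intro y hy
    obtain ⟨hyS, hR6, hhalf⟩ := hfar' y hy
    have hy1 : 1 ≤ ‖y‖ := by linarith
    have hy0 : 0 < ‖y‖ := one_pos.trans_le hy1
    have hr0 : 0 < Kerr.radius a (E4.ofTimeSpace 0 y) := by linarith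
    rw [(hgd y hy).fderiv]
    have hr := hrate _ hyS hR6
    calc ‖(fderiv ℝ Θ (E4.ofTimeSpace 0 y) - Λ).comp CoordSlice.incl‖
        ≤ ‖fderiv ℝ Θ (E4.ofTimeSpace 0 y) - Λ‖ * ‖(CoordSlice.incl : E3 →L[ℝ] E4)‖ :=
          ContinuousLinearMap.opNorm_comp_le _ _
      _ ≤ ‖fderiv ℝ Θ (E4.ofTimeSpace 0 y) - Λ‖ * 1 := by gcongr; exact norm_incl_le_one
      _ ≤ C₆ / Kerr.radius a (E4.ofTimeSpace 0 y) := by rw [mul_one]; exact hr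
      _ ≤ |C₆| / Kerr.radius a (E4.ofTimeSpace 0 y) := by gcongr; exact le_abs_self _
      _ ≤ |C₆| / (‖y‖ / 2) := div_le_div_of_nonneg_left (abs_nonneg _) (by positivity) hhalf
      _ = 2 * |C₆| * ‖y‖⁻¹ := by field_simp
      _ ≤ 2 * |C₆| * ‖y‖ ^ (-(1 / 2 : ℝ)) := by
          gcongr
          rw [← Real.rpow_neg_one]
          exact Real.rpow_le_rpow_of_exponent_le hy1 (by norm_num)
  obtain ⟨M₀, hM₀⟩ := TransitionRigidity.norm_le_of_norm_fderiv_le_rpow (F := E4) hR'0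
    (by norm_num : (1 / 2 : ℝ) < 1) (by positivity) (fun z hz ↦ (hgd z hz).differentiableAt) hbound
  -- transfer to `E4`
  refine ⟨2 * R', |M₀| + 8 * |C₆|, fun x hx hxR ↦ ?_⟩
  have hr0 : 0 < Kerr.radius a x := Kerr.radius_pos_of_mem_region hx
  have hr1 : 1 ≤ Kerr.radius a x := by linarith [hxR]
  have hsp : 2 * R' ≤ ‖E4.spatial x‖ := hxR.trans (Kerr.radius_le_spatialNorm a x)
  have hsp2 : ‖E4.spatial x‖ ≤ 2 * Kerr.radius a x := by
    have h := spatialNorm_le_radius_add hr0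
    have ha : |a| ≤ Kerr.radius a x := by
      linarith [le_max_left |a| 1, le_max_right (max R₆ (max (Kerr.rPlus M a) 0 + 1)) (max |a| 1)]
    change ‖E4.spatial x‖ ≤ Kerr.radius a x + |a| at h
    linarith
  -- `Θ x − Λ x = g(x_{space})`
  have e : Θ x - Λ x = g (E4.spatial x) := by
    have h1 : Θ x = Θ (E4.ofTimeSpace 0 (E4.spatial x)) + (c * E4.time x) • E4.basisVector 0 :=
      apply_eq_apply_foot_add hSinv hΘT hx
    have h2 : Λ x = Λ (E4.ofTimeSpace 0 (E4.spatial x)) + (c * E4.time x) • E4.basisVector 0 := by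
      conv_lhs => rw [← ofTimeSpace_zero_spatial_add_time_smul x]
      rw [map_add, map_smul, hΛ0, smul_smul, mul_comm]
    rw [h1, h2, hg_def]
    abel
  rw [e]
  have hM := hM₀ (E4.spatial x) (by linarith)
  refine hM.trans ?_
  have hsq : ‖E4.spatial x‖ ^ (1 - 1 / 2 : ℝ) ≤ 2 * Real.sqrt (Kerr.radius a x) := by
    rw [show (1 - 1 / 2 : ℝ) = 1 / 2 by norm_num, ← Real.sqrt_eq_rpow]
    calc Real.sqrt ‖E4.spatial x‖ ≤ Real.sqrt (4 * Kerr.radius a x) := Real.sqrt_le_sqrt (by linarith)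
      _ = 2 * Real.sqrt (Kerr.radius a x) := by
          rw [Real.sqrt_mul (by norm_num), show Real.sqrt 4 = 2 by
            rw [show (4 : ℝ) = 2 ^ 2 by norm_num, Real.sqrt_sq (by norm_num)]]
  have hs1 : 1 ≤ Real.sqrt (Kerr.radius a x) := by
    rw [← Real.sqrt_one]; exact Real.sqrt_le_sqrt hr1
  calc M₀ + 2 * |C₆| / (1 - 1 / 2) * ‖E4.spatial x‖ ^ (1 - 1 / 2 : ℝ)
      = M₀ + 4 * |C₆| * ‖E4.spatial x‖ ^ (1 - 1 / 2 : ℝ) := by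
        congr 1
        rw [show (2 * |C₆| / (1 - 1 / 2) : ℝ) = 4 * |C₆| by ring]
    _ ≤ |M₀| * Real.sqrt (Kerr.radius a x) + 4 * |C₆| * (2 * Real.sqrt (Kerr.radius a x)) := by
        gcongr
        exact (le_abs_self M₀).trans (le_mul_of_one_le_right (abs_nonneg _) hs1)
    _ = (|M₀| + 8 * |C₆|) * Real.sqrt (Kerr.radius a x) := by ring

end Summit.FinalStateConjecture.FinalStateConjecture.Theorems.SymplecticDualOfTheBomb

end
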